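import Summits.ResolutionOfSingularities.ResolutionOfSingularities.Theorems.RisoStrataRisoCentresResolveNonvacuity
import Summits.ResolutionOfSingularities.ResolutionOfSingularities.Theorems.RisoStrataRisoCurvesLoc
import Literature.AlgebraicGeometry.Resolution.QuadraticTransforms

/-!
# Route RisoStrata — crux `RisoCentresResolve` (stmt-ResolutionOfSingularities-18546), line `Sketch`
# v4: stub `stub_rcrCurveStep` (curve case: one riso step is one quadratic transform)

Let `k` be algebraically closed, `B ⊆ O` a finitely generated `k`-subalgebra of the field `K` of
Krull dimension `≤ 1` contained in the valuation ring `O`, whose local ring at the centre of `O`,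
`risoLoc O B = B_{𝔪_O ∩ B}` (as a subring, `locAtCentre B O`), is NOT regular, and let the cut
predicate `P` hold at every maximal ideal. For an admissible denominator `x` (`risoValid`:
`x ≠ 0`, `x ∈ Cen := risoCen P B d`, `Cen · x⁻¹ ⊆ O`) we prove (`stub_rcrCurveStep`) that the local
ring at the centre of `O` of the chart `risoStep P B d x = k[B ∪ Cen · x⁻¹]` is the quadratic
transform of `L := B_{𝔪_O ∩ B}` along `O`, i.e. the local blowing up of `L` along its maximal
ideal with respect to `O` (`IsQuadraticTransformAlong`, `IsLocalBlowupAlong`).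

Proof.
* The centre `𝔭 = 𝔪_O ∩ B` is a prime of the one-dimensional Noetherian domain `B`; it is not the
  generic point (the generic point is regular, `B_{(0)} = Frac B` being a field), hence maximal,
  and it is singular; as `P` holds there, `𝔭` is one of the maximal ideals cut out by `Cen`, so
  `Cen ⊆ 𝔭`.
* `Cen` contains some `f ≠ 0` (`rcr_exists_ne_zero_mem_risoCen`), so the maximal ideals cut out by
  `Cen` are among the finitely many maximal ideals over `(f)`; prime avoidance gives `s ∉ 𝔭` in
  all the others, whence `s · 𝔭 ⊆ Cen` with `s` a unit of `O`.
* Consequently `x` is `O`-minimal in all of `𝔭` (`(s a) x⁻¹ ∈ O` and `ν(s) = 0`), hence in the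
  maximal ideal `𝔪_L` of `L` (whose elements are `a / z`, `a ∈ 𝔭`, `ν(z) = 0`). Take as generators
  of `𝔪_L` (finitely generated: `L` is a localisation of the Noetherian `B`) any finite generating
  set together with `x`; `x` is a generator of minimal value.
* The two rings `k[B ∪ Cen · x⁻¹]` and `L[𝔪_L / x]` have the same local ring at the centre of `O`:
  `Cen ⊆ 𝔭 ⊆ 𝔪_L` gives `Cen · x⁻¹ ⊆ L[𝔪_L / x]`, and for `y = a / z ∈ 𝔪_L`,
  `y / x = ((s a) x⁻¹) / (s z)` with `(s a) x⁻¹ ∈ k[B ∪ Cen · x⁻¹]` and `ν(s z) = 0`.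
-/

noncomputable section

set_option linter.dupNamespace false -- mandated namespace of this single-conjunct summit

namespace Summit.ResolutionOfSingularities.ResolutionOfSingularities.Theorems

open Literature.AlgebraicGeometry.Resolution IsLocalRing

/-- Membership in the centre ideal `risoCen P B d`, unfolded: `a` lies in every singular maximal
ideal `m` with `P B m d`. [folklore] -/
private theorem rcrStep_mem_risoCen_iff {k K : Type} [Field k] [Field K] [Algebra k K]
    (P : ∀ B : Subalgebra k K, Ideal ↥B → ℕ → Prop) (B : Subalgebra k K) (d : ℕ)
    (a : ↥B) :
    a ∈ risoCen P B d ↔ ∀ (m : Ideal ↥B) (hm : m.IsMaximal),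
      ¬ IsRegularLocalRing (Localization (@Ideal.primeCompl ↥B _ m hm.isPrime)) → P B m d →
        a ∈ m := by
  simp only [risoCen, Submodule.mem_iInf, Set.mem_setOf_eq, forall_exists_index, and_imp]

/-- The generic point of a domain is a regular point: `A_{(0)} = Frac A` is a field. [folklore] -/
private theorem rcrStep_isRegularLocalRing_of_eq_bot {A : Type} [CommRing A] [IsDomain A]
    (q : Ideal A) [q.IsPrime] (hq : q = ⊥) : IsRegularLocalRing (Localization.AtPrime q) := by
  subst hq
  haveI : IsLocalization (nonZeroDivisors A) (Localization.AtPrime (⊥ : Ideal A)) := by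
    rw [← Ideal.primeCompl_bot]
    infer_instance
  have hF := (IsFractionRing.toField A (K := Localization.AtPrime (⊥ : Ideal A))).toIsField
  letI := hF.toField
  infer_instance

/-- **Prime avoidance at the singular centre.** For a finitely generated one-dimensional chart
`B ⊆ O` (`k` algebraically closed) whose local ring at the centre `𝔭 = 𝔪_O ∩ B` of `O` is singular,
and a cut predicate holding at all maximal ideals: the centre ideal `Cen = risoCen P B d` is
contained in `𝔭` (i.e. its elements have value `< 1`), and some `s ∈ B` of value `1` multiplies
`𝔭` into `Cen` (the maximal ideals cut out by `Cen` are finitely many, `𝔭` among them).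
[folklore] -/
private theorem rcrStep_exists_avoid {k K : Type} [Field k] [IsAlgClosed k] [Field K] [Algebra k K]
    (P : ∀ B : Subalgebra k K, Ideal ↥B → ℕ → Prop) (d : ℕ)
    (B : Subalgebra k K) (hB : B.FG) (hdim : ringKrullDim ↥B ≤ 1)
    (hP : ∀ m : Ideal ↥B, m.IsMaximal → P B m d)
    (O : ValuationSubring K) (hBO : B.toSubring ≤ O.toSubring)
    (hsing : ¬ IsRegularLocalRing ↥(risoLoc O B)) :
    (∀ a ∈ risoCen P B d, O.valuation (a : K) < 1) ∧
      ∃ s : ↥B, O.valuation (s : K) = 1 ∧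
        ∀ a : ↥B, O.valuation (a : K) < 1 → s * a ∈ risoCen P B d := by
  classical
  haveI : IsNoetherianRing ↥B := isNoetherianRing_of_fg hB
  haveI : Ring.KrullDimLE 1 ↥B := Ring.krullDimLE_iff.mpr hdim
  haveI : Ring.DimensionLEOne ↥B := ⟨fun h1 h2 => h2.isMaximal_of_ne_bot h1⟩
  -- the centre `𝔭 = 𝔪_O ∩ B`
  set p : Ideal ↥B := subringCentre B.toSubring O hBO
  haveI hpprime : p.IsPrime := subringCentre.isPrime B.toSubring O hBO
  have hmem : ∀ a : ↥B, a ∈ p ↔ O.valuation (a : K) < 1 := fun a =>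
    mem_subringCentre_iff hBO a
  have hpsing : ¬ IsRegularLocalRing (Localization.AtPrime p) := fun h =>
    hsing ((isRegularLocalRing_risoLoc_iff hBO).mpr h)
  have hp0 : p ≠ ⊥ := fun h => hpsing (rcrStep_isRegularLocalRing_of_eq_bot p h)
  have hpmax : p.IsMaximal := hpprime.isMaximal_of_ne_bot hp0
  -- `Cen ⊆ 𝔭`
  have hCenp : ∀ a ∈ risoCen P B d, O.valuation (a : K) < 1 := fun a ha =>
    (hmem a).mp ((rcrStep_mem_risoCen_iff P B d a).mp ha p hpmax hpsing (hP p hpmax))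
  -- some `f ≠ 0` lies in every singular maximal ideal; those over `(f)` are finitely many
  obtain ⟨f, hf0, hf⟩ := rcr_exists_ne_zero_mem_risoCen P B hB d
  have hTfin : {m : Ideal ↥B | m.IsMaximal ∧ Ideal.span {f} ≤ m}.Finite :=
    finite_setOf_isMaximal_le (Ideal.span {f}) (by rw [Ne, Ideal.span_singleton_eq_bot]; exact hf0)
  obtain ⟨s, hsp, hs⟩ := exists_not_mem_forall_mem_of_finite hTfin (fun m hm => hm.1) p hpmax
  refine ⟨hCenp, s, valuation_eq_one_of_not_mem_subringCentre hBO hsp, fun a ha => ?_⟩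
  refine (rcrStep_mem_risoCen_iff P B d (s * a)).mpr fun m hm hreg hPm => ?_
  by_cases hmp : m = p
  · rw [hmp]
    exact p.mul_mem_left s ((hmem a).mpr ha)
  · have hfm : f ∈ m := (rcrStep_mem_risoCen_iff P B d f).mp hf m hm hreg hPm
    exact m.mul_mem_right a (hs m ⟨hm, (Ideal.span_singleton_le_iff_mem m).mpr hfm⟩ hmp)

/-- **Stub (curves, the step).** On a finitely generated one-dimensional chart `B ⊆ O` over an
algebraically closed field whose local ring at the centre of `O` is singular, and for a cut
predicate holding at every maximal ideal, the riso chart `B[Cen(B,d)/x]` of an admissible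
denominator `x`, localised at the centre of `O`, is the quadratic transform of `B_{𝔪_O ∩ B}`
along `O` (Novacoski–Spivakovsky local blowing up of the maximal ideal): the centre ideal
localises to the maximal ideal (finitely many singular points, prime avoidance) and `x` is a
generator of it of minimal value. [folklore] -/
theorem stub_rcrCurveStep {k K : Type} [Field k] [IsAlgClosed k] [Field K] [Algebra k K]
    (P : ∀ B : Subalgebra k K, Ideal ↥B → ℕ → Prop) (d : ℕ)
    (B : Subalgebra k K) (hB : B.FG) (hdim : ringKrullDim ↥B ≤ 1)
    (hP : ∀ m : Ideal ↥B, m.IsMaximal → P B m d)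
    (O : ValuationSubring K) (hBO : B.toSubring ≤ O.toSubring)
    (hsing : ¬ IsRegularLocalRing ↥(risoLoc O B))
    (xt : K) (hx : risoValid P O B d xt) :
    IsQuadraticTransformAlong O (risoLoc O B).toSubring
      (risoLoc O (risoStep P B d xt)).toSubring := by
  classical
  -- the centre prime and the avoidance element
  obtain ⟨hCenp, s, hsv, hsCen⟩ := rcrStep_exists_avoid P d B hB hdim hP O hBO hsing
  obtain ⟨hxt0, ⟨x₀, hx₀Cen, hx₀eq⟩, hadm⟩ := id hx
  have hS₁O : (risoStep P B d xt).toSubring ≤ O.toSubring := risoStep_toSubring_le hBO hx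
  have hBS₁ : B.toSubring ≤ (risoStep P B d xt).toSubring := fun z hz => le_risoStep P B d xt hz
  have hs0 : (s : K) ≠ 0 := ne_zero_of_valuation_eq_one hsv
  have hxtB : xt ∈ B.toSubring := hx₀eq ▸ x₀.2
  -- `xt` has minimal value in the whole centre prime `𝔪_O ∩ B`
  have hvxt : O.valuation xt < 1 := hx₀eq ▸ hCenp x₀ hx₀Cen
  have hxtpos : 0 < O.valuation xt := by
    rw [pos_iff_ne_zero]
    simpa using hxt0
  have hmin : ∀ a : ↥B, O.valuation (a : K) < 1 → O.valuation (a : K) ≤ O.valuation xt := by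
    intro a ha
    have h : (s : K) * (a : K) * xt⁻¹ ∈ O := by
      have := hadm (s * a) (hsCen a ha)
      rwa [MulMemClass.coe_mul] at this
    rw [← O.valuation_le_one_iff, map_mul, map_mul, hsv, one_mul, map_inv₀,
      mul_inv_le_iff₀ hxtpos, one_mul] at h
    exact h
  -- the source is `L = B_{𝔪_O ∩ B}`, a Noetherian local ring
  rw [risoLoc_toSubring_eq hBO, risoLoc_toSubring_eq hS₁O]
  set L := locAtCentre B.toSubring O
  haveI hLloc : IsLocalRing L := isLocalRing_locAtCentre hBO
  haveI := isLocalization_locAtCentre hBO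
  haveI : IsNoetherianRing L :=
    IsLocalization.isNoetherianRing (subringCentre B.toSubring O hBO).primeCompl L
      (isNoetherianRing_of_fg hB)
  -- values on the maximal ideal of `L` are bounded below by the value of `xt`
  have hLval : ∀ y : L, y ∈ maximalIdeal L → O.valuation (y : K) ≤ O.valuation xt := by
    intro y hy
    have hy' := (mem_maximalIdeal_locAtCentre_iff hBO y).mp hy
    obtain ⟨a, ha, z, hz, hvz, hyeq⟩ := (mem_locAtCentre_iff).mp y.2
    rw [hyeq, map_div₀, hvz, div_one] at hy' ⊢
    exact hmin ⟨a, ha⟩ hy'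
  -- for `y ∈ 𝔪_L`, `y / xt` lies in the local ring of the chart at the centre of `O`
  have hkeyS : ∀ y : L, y ∈ maximalIdeal L →
      (y : K) / xt ∈ locAtCentre (risoStep P B d xt).toSubring O := by
    intro y hy
    have hy' := (mem_maximalIdeal_locAtCentre_iff hBO y).mp hy
    obtain ⟨a, ha, z, hz, hvz, hyeq⟩ := (mem_locAtCentre_iff).mp y.2
    have hva : O.valuation a < 1 := by rwa [hyeq, map_div₀, hvz, div_one] at hy'
    have hz0 : z ≠ 0 := ne_zero_of_valuation_eq_one hvz
    refine ⟨(s : K) * a * xt⁻¹, ?_, (s : K) * z, ?_, ?_, ?_⟩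
    · have := mul_inv_mem_risoStep P (xt := xt) (hsCen ⟨a, ha⟩ hva)
      simpa only [MulMemClass.coe_mul, Subalgebra.mem_toSubring] using this
    · exact hBS₁ (B.mul_mem s.2 hz)
    · rw [map_mul, hsv, hvz, one_mul]
    · rw [hyeq]
      field_simp
  -- generators of `𝔪_L`: a finite generating set together with `xt`
  obtain ⟨u', hu'⟩ : ∃ u' : Finset L, Ideal.span (↑u' : Set L) = maximalIdeal L :=
    IsNoetherian.noetherian (maximalIdeal L)
  set x₁ : L := ⟨xt, le_locAtCentre _ O hxtB⟩
  have hx₁max : x₁ ∈ maximalIdeal L := (mem_maximalIdeal_locAtCentre_iff hBO x₁).mpr hvxt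
  have hspan : Ideal.span (↑(insert x₁ u') : Set L) = maximalIdeal L := by
    rw [Finset.coe_insert, Ideal.span_insert, hu', sup_eq_right]
    exact (Ideal.span_singleton_le_iff_mem _).mpr hx₁max
  have hx₁0 : x₁ ≠ 0 := fun h => hxt0 (congrArg Subtype.val h)
  have hval :
      ∀ y ∈ insert x₁ u', O.valuation ((y : L) : K) ≤ O.valuation ((x₁ : L) : K) := by
    intro y hy
    refine hLval y ?_
    rw [← hspan]
    exact Ideal.subset_span (Finset.mem_coe.mpr hy)
  refine ⟨hLloc, locAtCentre_le hBO, insert x₁ u', x₁, hspan, Finset.mem_insert_self _ _,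
    hx₁0, hval, ?_⟩
  -- the ring equality: both rings have the same local ring at the centre of `O`
  show locAtCentre (risoStep P B d xt).toSubring O =
    locAtCentre (Subring.closure
      ((L : Set K) ∪ (fun y : L => (y : K) / (x₁ : K)) '' ↑(insert x₁ u'))) O
  set C := Subring.closure
    ((L : Set K) ∪ (fun y : L => (y : K) / (x₁ : K)) '' ↑(insert x₁ u'))
  -- every element of `𝔪_L`, divided by `xt`, lies in `C`
  have hkeyC : ∀ y : L, y ∈ maximalIdeal L → (y : K) / xt ∈ C := by
    intro y hy
    rw [← hspan] at hy
    induction hy using Submodule.span_induction with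
    | mem y hy => exact Subring.subset_closure (Or.inr ⟨y, hy, rfl⟩)
    | zero => simp
    | add y y' _ _ hy hy' => rw [Subring.coe_add, add_div]; exact C.add_mem hy hy'
    | smul a y _ hy =>
      rw [smul_eq_mul, Subring.coe_mul, mul_div_assoc]
      exact C.mul_mem (Subring.subset_closure (Or.inl a.2)) hy
  -- the chart lies in `C_{𝔪_O ∩ C}`
  have hE1 : (risoStep P B d xt).toSubring ≤ locAtCentre C O := by
    let LC : Subalgebra k K :=
      { locAtCentre C O with
        algebraMap_mem' := fun c => le_locAtCentre C O
          (Subring.subset_closure (Or.inl (le_locAtCentre B.toSubring O (B.algebraMap_mem c)))) }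
    have hle : risoStep P B d xt ≤ LC := by
      refine Algebra.adjoin_le ?_
      rintro y (hy | ⟨a, ha, rfl⟩)
      · exact le_locAtCentre C O
          (Subring.subset_closure (Or.inl (le_locAtCentre B.toSubring O hy)))
      · have ha' : (⟨(a : K), le_locAtCentre B.toSubring O a.2⟩ : L) ∈ maximalIdeal L :=
          (mem_maximalIdeal_locAtCentre_iff hBO _).mpr (hCenp a ha)
        have := le_locAtCentre C O (hkeyC _ ha')
        rwa [← div_eq_mul_inv]
    exact fun y hy => hle hy
  -- `C` lies in the local ring of the chart at the centre of `O`
  have hE2 : C ≤ locAtCentre (risoStep P B d xt).toSubring O := by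
    refine Subring.closure_le.mpr ?_
    rintro y (hy | ⟨y', hy', rfl⟩)
    · exact locAtCentre_mono O hBS₁ hy
    · refine hkeyS y' ?_
      rw [← hspan]
      exact Ideal.subset_span hy'
  apply le_antisymm
  · calc locAtCentre (risoStep P B d xt).toSubring O
        ≤ locAtCentre (locAtCentre C O) O := locAtCentre_mono O hE1
      _ = locAtCentre C O := locAtCentre_locAtCentre C O
  · calc locAtCentre C O
        ≤ locAtCentre (locAtCentre (risoStep P B d xt).toSubring O) O := locAtCentre_mono O hE2
      _ = locAtCentre (risoStep P B d xt).toSubring O := locAtCentre_locAtCentre _ O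

end Summit.ResolutionOfSingularities.ResolutionOfSingularities.Theorems

end
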